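import Summits.QuantumFields.YangMills.Theorems.BalabanUVNodesN17HistModuliContRecord13
import Summits.QuantumFields.YangMills.Theorems.BalabanUVNodesN18KernelStepRateBoxes
import Summits.QuantumFields.YangMills.Theorems.BalabanUVNodesD4KernelDecayOfWindowed
import Literature.MathematicalPhysics.QuantumFieldTheory.Balaban1983to89.Node00.U3KernelLetters

/-!
# BalabanUVNodes ∕ node N17 = NE4 = node U2's input — NODE U2's WHOLE INPUT TRIPLE `U2Inputs` (N17 ∧ history moduli ∧ fading memory) AT THE
# STAGE-13 RECORD IN KERNEL CURRENCY AND IN node00-def-W1's FINITE-VOLUME LETTER CURRENCY (`Node00/U3KernelLetters`, W1-19b), WITH ITS TWO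
# K2⁷ LINE-2 CONSUMERS (`stub_n17AtRecord13`'s body and S3 `stub_cont13`'s body) READ OFF THE SAME FOUR LETTERS

Cell `pub-ymgap` (HUMAN RULINGS D-0062 ∕ D-0149), WIDTH SEAT `pub-ymgap-dag-n17-w3` (seat 3 of 3 on NODE n17), generation 2, INTENT-2 (successor of
`…N17HistModuliContRecord13`, p597231).  THEOREMS ONLY (0 `def`, 0 `instance`, 0 `notation`, 0 `sorry`); filed `--kind proof --supports
stmt-QuantumFields-20544 --as helper` (K3⁷ `SpineGivenEndpointR13SepCoPH`); K2⁷ (stmt-QuantumFields-20543) served BY NAME through its line-2 stub bodies.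
COUNT-NEUTRAL.

THE POINT.  Node U2's input on a datum `D` is the triple `Spine.NE4.U2Inputs D c C ρ γ Λ = ScaleShiftRate c ρ γ D.βfun ∧ HistLipschitz Λ γ D.βfun ∧
FadingMemory C ρ Λ`; at node U3's carriers it is `YMDAG.N17.u2Inputs_of_readOutAt` ((D4) ∧ N18 ∧ N22, dag-n17-a).  K3⁷ v3 pins node U3's objects to
node00-def-W1's KERNEL OBJECTS OF RECORD `U3OfKernels.objectsOfRecord₁₃ F N θ ℓ` (`U3PinnedKernels`), where the three slots have producers in two
currencies: KERNEL currency — (D4) ⟸ (5.10) of record `KernelDecayOfRecord₁₃` + letter rows (dag-n27-w1 `readOutAt_objectsOfRecord₁₃_coPH`), N22 ⟺ NE9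
of the kernel functional (dag-n22-w3), N18 at the bundle —, and def-W1's FINITE-VOLUME LETTER currency — `PolLimitsExistOfRecord₁₃` ((1.21) exists on the
window), `WindowedDecayOfRecord₁₃ 0 1 κ` (⟹ (5.10), dag-n22-w3 `kernelDecayOfRecord₁₃_of_windowed`), `WindowedNE9OfRecord₁₃ κ Λ` (⟹ N22, dag-n22-w3
`n22At_u3OfRecord₁₃_objectsOfRecord₁₃_of_windowed`), `WindowedStepRateOfRecord₁₃ s κ θ₅ (C₅θ₅)` (⟹ N18, dag-n18-w1 `n18At_u3OfRecord₁₃_objectsOfRecord₁₃_of_finiteVolume`).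
THIS FILE assembles NODE U2's WHOLE TRIPLE at the record in both currencies (§1 kernel, §2 letters) — constants DISPLAYED: `c = ℓ.cr·ℓ.C₅·ℓ.θ₅`, `C =
ℓ.cr·ℓ.C₉·ℓ.ω`, rate `ℓ.ρ`, box `θ.γ`, moduli `Λ k i = ℓ.cr·ℓ.C₉·ℓ.ω^{k+1−i}` — and reads off it the two K3⁷-derived stub bodies of K2⁷ LINE 2 (§3): ONE
letter block per admissible tuple carrying the four letters + signs inhabits BOTH `N17AtRecord13`'s and `ContRecord13`'s bodies.  The N17 conjunct alone at
the kernel objects is dag-n17-w1's `…N17AtU3OfKernels` (cited, not restated: here it appears only inside the triple); the N22∕S3 half alone is p597231 §4.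
ADJACENCY (dag-n22-w3 g2 INTENT-7 `…N22KernelsBetaHistLipschitz`, announced 2026-08-28T02:12Z): that file derives node U2's moduli PAIR at the kernel
objects by the SHARPER generic road `T4BetaReadOutLipschitz.secondMoment_sub_abs_le` (constant `betaPrime510 4 1 κ·Λ`, no `cr` row); here the pair is read
through the (D4) closer (constant `ℓ.cr·Λ` under `betaPrime510 4 1 κ ≤ cr`) only as a component of the WHOLE triple and in def-W1's LETTER currency — names
disjoint (`u2HistModuli_…`, `u2FadingMemory_…`), nothing of that file restated.

WHAT IS KERNEL-CHECKED (compositions BY NAME; nothing restated):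
* §1 KERNEL CURRENCY at `objectsOfRecord₁₃` (`N`-generic, `CoPH` keys, every run length `k`) (+ `u2Inputs_of_pHolderD4_body`: K3⁷ v3's rates body
  `RatesHolderAt ∧ ReadOutAt ∧ ρ-letters` carries the whole triple on any bundle): `u2HistModuli_betaOfRecord₁₃_of_readOut_kernels` (node U2's SECOND input:
  (5.10) + letter rows + NE9 of the kernel functional ⟹ `HistLipschitz (k i ↦ ℓ.cr·ℓ.moduli (k+1) i) θ.γ β₁₃`; no N18) · `u2FadingMemory_of_signs` (THIRD
  input from the signs alone) · ★ `u2Inputs_datumOfRecord₁₃CoPH_of_kernels` (the WHOLE triple ⟸ (5.10) + rows + N18 ∧ N22 at the level-`k` bundle).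
* §2 LETTER CURRENCY: ★★ `u2Inputs_datumOfRecord₁₃CoPH_of_kernelLetters` (the WHOLE triple ⟸ `ℓ.Signs ∧ 0 < ℓ.κ ∧ betaPrime510 4 1 ℓ.κ ≤ ℓ.cr` + the FOUR
  letters) · `u2HistModuli_betaOfRecord₁₃_of_threeLetters` ∕ `betaContH_betaOfRecord₁₃_of_threeLetters` (three letters — no step rate) ·
  `scaleShiftRate_betaOfRecord₁₃_of_fourLetters` (N17's sentence at the record off the four letters; = dag-n17-w1's N17-at-kernels conclusion reached
  through the triple — cited).
* §3 K2⁷ LINE 2 off the letters (`N = 2`, texts LITERALLY): `contRecord13Body_of_threeLetters` (S3) · ★ `n17Body_and_contBody_of_fourLetters` (BOTH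
  K3⁷-derived line-2 bodies from ONE letter reading `ℓ F θ` with the four letters + signs per admissible tuple; witness = the level-0 kernel bundle,
  `u.γ = θ.γ` by `rfl`, `0 ≤ u.ρ < 1` from `Signs`).

HONEST FRAMING.  Count-neutral helper; bookkeeping BY NAME over typed SHAPES; every letter ∕ clause — (1.21)-existence on the window, windowed (5.10),
windowed NE9, windowed two-run step rate, the signs — is a HYPOTHESIS on Bałaban's merged term (1.6), inhabited for no family here; NE5 ∕ NE9 NOT PRINTED
for d = 4 and NOT proved; (5.10) for the merged kernels is print's claim ([Balaban1987RG1] p. 293), NOT proved here; `stub_n17AtRecord13` ∕ `stub_cont13` ∕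
`stub_rates13H` NOT proved; N17 ∕ N18 ∕ N22 ∕ N26 NOT discharged; K2⁷ ∕ K3⁷ OPEN, NOT claimed; counts UNMOVED (typed 28∕28 · discharged 5∕27 (A 5∕28));
one finite 𝕋⁴ programme at fixed ε — R4 closes the conditional rung `BalabanLadder.UV` only; the Yang–Mills mass gap (Clay) is NOT proved by any of this
— nothing continuum ∕ ℝ⁴ ∕ OS ∕ mass gap ∕ Clay.
References (locators only): [Balaban1987RG1] = T. Bałaban, CMP **109** (1987): (1.6) p. 261, (1.20)–(1.22) p. 264, (5.10) p. 293, §5 p. 298.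
-/

noncomputable section

open scoped Matrix.Norms.L2Operator

namespace YMDAG.N17.U2TripleLetters

open Literature.MathematicalPhysics.QuantumFieldTheory.Balaban1983to89
open Literature.MathematicalPhysics.QuantumFieldTheory.Balaban1983to89.FlowStep
open Literature.MathematicalPhysics.QuantumFieldTheory.Balaban1983to89.T4CouplingMatching (ScaleShiftRate HistLipschitz)
open Literature.MathematicalPhysics.QuantumFieldTheory.Balaban1983to89.T4Continuum (T4Family ULoop)
open Literature.MathematicalPhysics.QuantumFieldTheory.Balaban1983to89.T4OutputRate (Window NE9)
open Literature.MathematicalPhysics.QuantumFieldTheory.Balaban1983to89.T4BetaReadOut (fadingMemory_readOut)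
open Literature.MathematicalPhysics.QuantumFieldTheory.Balaban1983to89.T4FlagMemory (fadingMemory_mono)
open Literature.MathematicalPhysics.QuantumFieldTheory.Balaban1983to89.B12Sec2to5 (betaPrime510)
open Literature.MathematicalPhysics.QuantumFieldTheory.Balaban1983to89.Node00
open Literature.MathematicalPhysics.QuantumFieldTheory.Balaban1983to89.Node00.U3OfKernels (objectsOfRecord₁₃ KernelDecayOfRecord₁₃)
open Literature.MathematicalPhysics.QuantumFieldTheory.Balaban1983to89.Node00.U3KernelLetters
  (PolLimitsExistOfRecord₁₃ WindowedDecayOfRecord₁₃ WindowedNE9OfRecord₁₃ WindowedStepRateOfRecord₁₃)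
open Summit.QuantumFields.BalabanUV.T4Continuum.Spine.NE4 (U2Inputs)
open YMDAG.UVSplit
open Summit.QuantumFields.YangMills.BalabanUVNodes.N27ReadOutAtU3OfKernels (readOutAt_objectsOfRecord₁₃_coPH)
open YMDAG.N22.AtKernels (n22At_u3OfRecord₁₃_objectsOfRecord₁₃_iff n22At_u3OfRecord₁₃_objectsOfRecord₁₃_of_windowed kernelDecayOfRecord₁₃_of_windowed)
open YMDAG.N18.KernelStepRateBoxes (n18At_u3OfRecord₁₃_objectsOfRecord₁₃_of_finiteVolume)
open YMDAG.N17.HistModuliCont (histLipschitz_of_readOutAt_ne9 betaContH_merged_of_readOutAt_n22)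

variable {N : ℕ} [NeZero N] {F : T4Family}

/-! ## §1 KERNEL CURRENCY: node U2's triple at the kernel objects of record -/

section Kernels

/-- **NODE U2's SECOND INPUT AT THE KERNEL OBJECTS OF RECORD** (no N18 ∕ NE5): the letter rows `ℓ.Signs`, `0 < ℓ.κ`, `betaPrime510 4 1 ℓ.κ ≤ ℓ.cr`, the
(5.10) clause of record (⟹ (D4) at the level-`k` bundle, dag-n27-w1) and NE9 of the level-`k` kernel functional of record on the window give the HISTORY
MODULI of def-T's `betaOfRecord₁₃` on the `θ.γ`-boxes: `|β_{k+1}(p) − β_{k+1}(q)| ≤ Σ_i ℓ.cr·ℓ.C₉·ℓ.ω^{k+1−i}·|p_i − q_i|` (p597231 §1 at the bundle).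
Hypotheses throughout. [cite: Balaban1987RG1, (5.10) p.293 and §5 p.298] -/
theorem u2HistModuli_betaOfRecord₁₃_of_readOut_kernels (θ : Stage13HParams F N) (hP : θ.Provisos₁₃CoPH F N) (ℓ : U3Letters₁₁) (hs : ℓ.Signs)
    (hκ : 0 < ℓ.κ) (hcr : betaPrime510 4 1 ℓ.κ ≤ ℓ.cr) (hdec : KernelDecayOfRecord₁₃ F N θ.toStage13Params 0 1 ℓ.κ) (k : ℕ)
    (h9 : NE9 ((objectsOfRecord₁₃ F N θ.toStage13Params ℓ).EA k) (Window θ.γ) ℓ.κ ℓ.moduli) :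
    HistLipschitz (fun a i => ℓ.cr * ℓ.moduli (a + 1) i) θ.γ (betaOfRecord₁₃ F N θ.toStage13Params) := by
  have h := histLipschitz_of_readOutAt_ne9 (datumOfRecord₁₃CoPH F N θ hP) (readOutAt_objectsOfRecord₁₃_coPH θ hP ℓ hs hκ hcr k hdec) h9
  rw [βfun_datumOfRecord₁₃CoPH] at h
  exact h

/-- **NODE U2's THIRD INPUT FROM THE SIGNS ALONE**: the read-out moduli `ℓ.cr·ℓ.moduli (k+1) i = ℓ.cr·ℓ.C₉·ℓ.ω^{k+1−i}` have fading memory with constant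
`ℓ.cr·ℓ.C₉·ℓ.ω` at the joint rate `ℓ.ρ` (`T4BetaReadOut.fadingMemory_readOut` on the by-construction fading of `ℓ.moduli`, then `fadingMemory_mono` along
`ℓ.ω ≤ ℓ.ρ`). [folklore] -/
theorem u2FadingMemory_of_signs (ℓ : U3Letters₁₁) (hs : ℓ.Signs) :
    T4CouplingMatching.FadingMemory (ℓ.cr * ℓ.C₉ * ℓ.ω) ℓ.ρ (fun a i => ℓ.cr * ℓ.moduli (a + 1) i) := by
  have hΛ : T4OutputRate.FadingMemory ℓ.C₉ ℓ.ω ℓ.moduli := fun a i _ => ⟨hs.moduli_nonneg a i, le_rfl⟩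
  exact fadingMemory_mono (mul_nonneg (mul_nonneg hs.cr_nonneg hs.C₉_nonneg) hs.ω_nonneg) hs.ω_nonneg hs.ω_le_ρ (fadingMemory_readOut hΛ hs.cr_nonneg)

/-- ★ **NODE U2's WHOLE INPUT TRIPLE AT THE v1.7 `CoPH` DATUM OF RECORD FROM THE KERNEL OBJECTS OF RECORD**: the letter rows, the (5.10) clause of record,
and N18 ∧ N22 at the level-`k` bundle `u3OfRecord₁₃ θ (objectsOfRecord₁₃ F N θ ℓ) k` give `U2Inputs D₁₃ (ℓ.cr·ℓ.C₅·ℓ.θ₅) (ℓ.cr·ℓ.C₉·ℓ.ω) ℓ.ρ θ.γ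
(k i ↦ ℓ.cr·ℓ.moduli (k+1) i)` — dag-n17-a `YMDAG.N17.u2Inputs_of_readOutAt` at (D4) := dag-n27-w1's closer.  Its first conjunct is node N17 at the kernel
objects (dag-n17-w1 `…N17AtU3OfKernels`, same inputs), its second the moduli of `u2HistModuli_betaOfRecord₁₃_of_readOut_kernels`. [bookkeeping] -/
theorem u2Inputs_datumOfRecord₁₃CoPH_of_kernels (θ : Stage13HParams F N) (hP : θ.Provisos₁₃CoPH F N) (ℓ : U3Letters₁₁) (hs : ℓ.Signs)
    (hκ : 0 < ℓ.κ) (hcr : betaPrime510 4 1 ℓ.κ ≤ ℓ.cr) (hdec : KernelDecayOfRecord₁₃ F N θ.toStage13Params 0 1 ℓ.κ) (k : ℕ)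
    (h18 : N18At (u3OfRecord₁₃ θ.toStage13Params (objectsOfRecord₁₃ F N θ.toStage13Params ℓ) k))
    (h22 : N22At (u3OfRecord₁₃ θ.toStage13Params (objectsOfRecord₁₃ F N θ.toStage13Params ℓ) k)) :
    U2Inputs (datumOfRecord₁₃CoPH F N θ hP) (ℓ.cr * ℓ.C₅ * ℓ.θ₅) (ℓ.cr * ℓ.C₉ * ℓ.ω) ℓ.ρ θ.γ (fun a i => ℓ.cr * ℓ.moduli (a + 1) i) :=
  YMDAG.N17.u2Inputs_of_readOutAt (datumOfRecord₁₃CoPH F N θ hP) (readOutAt_objectsOfRecord₁₃_coPH θ hP ℓ hs hκ hcr k hdec) h18 h22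

/-- **K3⁷ v3's RATES PREDICATE `PHolderD4 β D R` (body SPELLED) CARRIES NODE U2's WHOLE TRIPLE ON THE BUNDLE's WINDOW** (any datum, any bundle): only
(D4), N18, N22 are read (N14 ∕ N15 ∕ N16 ∕ N17 and the junction letter `ρ` idle) — dag-n17-a `u2Inputs_of_readOutAt`; companion of p597231's
`betaContH_of_pHolderD4_body` (which keeps the second conjunct only). [bookkeeping] -/
theorem u2Inputs_of_pHolderD4_body {D : Datum F N} {R : RateCarriers N} {β : ℝ}
    (h : Summit.QuantumFields.YangMills.BalabanUVNodes.SpineRatesHolder.RatesHolderAt D R β ∧ ReadOutAt D R.u3 ∧ (0 ≤ R.u3.ρ ∧ R.u3.ρ < 1)) :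
    U2Inputs D (R.u3.cr * R.u3.C₅ * R.u3.θ) (R.u3.cr * R.u3.C₉ * R.u3.ω) R.u3.ρ R.u3.γ (fun a i => R.u3.cr * R.u3.Λ (a + 1) i) :=
  YMDAG.N17.u2Inputs_of_readOutAt D h.2.1 h.1.2.2.2.2.1 h.1.2.2.2.2.2

end Kernels

/-! ## §2 LETTER CURRENCY: node U2's triple at the record from node00-def-W1's four finite-volume letters -/

section Letters

/-- ★★ **NODE U2's WHOLE INPUT TRIPLE AT THE RECORD FROM THE FOUR FINITE-VOLUME LETTERS** (node00-def-W1 `Node00/U3KernelLetters`): the letter rows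
`ℓ.Signs`, `0 < ℓ.κ`, `betaPrime510 4 1 ℓ.κ ≤ ℓ.cr` and, for the merged term family of record in the record's β-chart, (i) `PolLimitsExistOfRecord₁₃`
((1.21) exists along the window), (ii) `WindowedDecayOfRecord₁₃ 0 1 ℓ.κ` (windowed (5.10) ⟹ the clause of record, dag-n22-w3 `kernelDecayOfRecord₁₃_of_windowed`),
(iii) `WindowedNE9OfRecord₁₃ ℓ.κ ℓ.moduli` (⟹ N22 at the kernel bundle, dag-n22-w3), (iv) `WindowedStepRateOfRecord₁₃ s ℓ.κ ℓ.θ₅ (ℓ.C₅·ℓ.θ₅)` (⟹ N18 at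
the kernel bundle, dag-n18-w1 `n18At_u3OfRecord₁₃_objectsOfRecord₁₃_of_finiteVolume`) ⟹ `U2Inputs D₁₃ (ℓ.cr·ℓ.C₅·ℓ.θ₅) (ℓ.cr·ℓ.C₉·ℓ.ω) ℓ.ρ θ.γ (k i ↦
ℓ.cr·ℓ.moduli (k+1) i)`.  Every letter a HYPOTHESIS on Bałaban's (1.6) merged term; nothing supplied. [cite: Balaban1987RG1, (1.20)–(1.22) p.264 and (1.6) p.261] -/
theorem u2Inputs_datumOfRecord₁₃CoPH_of_kernelLetters (θ : Stage13HParams F N) (hP : θ.Provisos₁₃CoPH F N) (ℓ : U3Letters₁₁) (hs : ℓ.Signs)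
    (hκ : 0 < ℓ.κ) (hcr : betaPrime510 4 1 ℓ.κ ≤ ℓ.cr) (s : ℕ) (hlim : PolLimitsExistOfRecord₁₃ F N θ.toStage13Params)
    (hdec : WindowedDecayOfRecord₁₃ F N θ.toStage13Params 0 1 ℓ.κ) (h9 : WindowedNE9OfRecord₁₃ F N θ.toStage13Params ℓ.κ ℓ.moduli)
    (h5 : WindowedStepRateOfRecord₁₃ F N θ.toStage13Params s ℓ.κ ℓ.θ₅ (ℓ.C₅ * ℓ.θ₅)) :
    U2Inputs (datumOfRecord₁₃CoPH F N θ hP) (ℓ.cr * ℓ.C₅ * ℓ.θ₅) (ℓ.cr * ℓ.C₉ * ℓ.ω) ℓ.ρ θ.γ (fun a i => ℓ.cr * ℓ.moduli (a + 1) i) :=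
  u2Inputs_datumOfRecord₁₃CoPH_of_kernels θ hP ℓ hs hκ hcr (kernelDecayOfRecord₁₃_of_windowed F N θ.toStage13Params 0 1 ℓ.κ hlim hdec) 0
    (n18At_u3OfRecord₁₃_objectsOfRecord₁₃_of_finiteVolume F N θ.toStage13Params ℓ 0 s hlim h5)
    (n22At_u3OfRecord₁₃_objectsOfRecord₁₃_of_windowed F N θ.toStage13Params ℓ hs 0 hlim h9)

/-- **NODE U2's SECOND INPUT FROM THREE LETTERS** (no step rate ∕ N18): rows + `PolLimitsExistOfRecord₁₃` + `WindowedDecayOfRecord₁₃ 0 1 ℓ.κ` +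
`WindowedNE9OfRecord₁₃ ℓ.κ ℓ.moduli` ⟹ the history moduli of `betaOfRecord₁₃` on the `θ.γ`-boxes. [cite: Balaban1987RG1, §5 p.298 and (5.10) p.293] -/
theorem u2HistModuli_betaOfRecord₁₃_of_threeLetters (θ : Stage13HParams F N) (hP : θ.Provisos₁₃CoPH F N) (ℓ : U3Letters₁₁) (hs : ℓ.Signs)
    (hκ : 0 < ℓ.κ) (hcr : betaPrime510 4 1 ℓ.κ ≤ ℓ.cr) (hlim : PolLimitsExistOfRecord₁₃ F N θ.toStage13Params)
    (hdec : WindowedDecayOfRecord₁₃ F N θ.toStage13Params 0 1 ℓ.κ) (h9 : WindowedNE9OfRecord₁₃ F N θ.toStage13Params ℓ.κ ℓ.moduli) :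
    HistLipschitz (fun a i => ℓ.cr * ℓ.moduli (a + 1) i) θ.γ (betaOfRecord₁₃ F N θ.toStage13Params) :=
  u2HistModuli_betaOfRecord₁₃_of_readOut_kernels θ hP ℓ hs hκ hcr (kernelDecayOfRecord₁₃_of_windowed F N θ.toStage13Params 0 1 ℓ.κ hlim hdec) 0
    ((n22At_u3OfRecord₁₃_objectsOfRecord₁₃_iff F N θ.toStage13Params ℓ hs 0).1
      (n22At_u3OfRecord₁₃_objectsOfRecord₁₃_of_windowed F N θ.toStage13Params ℓ hs 0 hlim h9))

/-- **β-CONTINUITY ON THE RECORD's BOXES FROM THE SAME THREE LETTERS** (`T4BetaStationary.betaContH_of_histLipschitz`). [folklore] -/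
theorem betaContH_betaOfRecord₁₃_of_threeLetters (θ : Stage13HParams F N) (hP : θ.Provisos₁₃CoPH F N) (ℓ : U3Letters₁₁) (hs : ℓ.Signs)
    (hκ : 0 < ℓ.κ) (hcr : betaPrime510 4 1 ℓ.κ ≤ ℓ.cr) (hlim : PolLimitsExistOfRecord₁₃ F N θ.toStage13Params)
    (hdec : WindowedDecayOfRecord₁₃ F N θ.toStage13Params 0 1 ℓ.κ) (h9 : WindowedNE9OfRecord₁₃ F N θ.toStage13Params ℓ.κ ℓ.moduli) :
    BetaContH θ.γ (betaOfRecord₁₃ F N θ.toStage13Params) :=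
  T4BetaStationary.betaContH_of_histLipschitz (u2HistModuli_betaOfRecord₁₃_of_threeLetters θ hP ℓ hs hκ hcr hlim hdec h9)

/-- **NODE N17's SENTENCE AT THE RECORD OFF THE FOUR LETTERS** (the triple's FIRST conjunct: `ScaleShiftRate (ℓ.cr·ℓ.C₅·ℓ.θ₅) ℓ.ρ θ.γ (betaOfRecord₁₃ …)`;
dag-n17-w1's `…N17AtU3OfKernels` reaches the same sentence by its (D4)- and kernel-roads — cited; here it is merely projected out of the triple).
[cite: Balaban1987RG1, (1.20)–(1.22) p.264] -/
theorem scaleShiftRate_betaOfRecord₁₃_of_fourLetters (θ : Stage13HParams F N) (hP : θ.Provisos₁₃CoPH F N) (ℓ : U3Letters₁₁) (hs : ℓ.Signs)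
    (hκ : 0 < ℓ.κ) (hcr : betaPrime510 4 1 ℓ.κ ≤ ℓ.cr) (s : ℕ) (hlim : PolLimitsExistOfRecord₁₃ F N θ.toStage13Params)
    (hdec : WindowedDecayOfRecord₁₃ F N θ.toStage13Params 0 1 ℓ.κ) (h9 : WindowedNE9OfRecord₁₃ F N θ.toStage13Params ℓ.κ ℓ.moduli)
    (h5 : WindowedStepRateOfRecord₁₃ F N θ.toStage13Params s ℓ.κ ℓ.θ₅ (ℓ.C₅ * ℓ.θ₅)) :
    ScaleShiftRate (ℓ.cr * ℓ.C₅ * ℓ.θ₅) ℓ.ρ θ.γ (betaOfRecord₁₃ F N θ.toStage13Params) := by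
  have h := (u2Inputs_datumOfRecord₁₃CoPH_of_kernelLetters θ hP ℓ hs hκ hcr s hlim hdec h9 h5).1
  rw [βfun_datumOfRecord₁₃CoPH] at h
  exact h

end Letters

/-! ## §3 K2⁷ LINE 2 OFF THE LETTERS (`N = 2`, texts LITERALLY): S3, and both K3⁷-derived bodies from ONE letter reading -/

section Line2

/-- **S3 `stub_cont13 : ContRecord13` — ITS BODY, LITERALLY, FROM A LETTER READING `ℓ` CARRYING THREE LETTERS + ROWS per admissible ⁷ tuple**
(`PolLimitsExistOfRecord₁₃`, `WindowedDecayOfRecord₁₃ 0 1 κ`, `WindowedNE9OfRecord₁₃ κ Λ`; no step rate).  Hypotheses; nothing discharged. [bookkeeping] -/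
theorem contRecord13Body_of_threeLetters (ℓ : (F : T4Family) → Stage13HParams F 2 → U3Letters₁₁)
    (h : ∀ (F : T4Family) (θ : Stage13HParams F 2) (hP : θ.Provisos₁₃SepCoPH F 2), θ.Admissible F 2 →
      (ℓ F θ).Signs ∧ 0 < (ℓ F θ).κ ∧ betaPrime510 4 1 (ℓ F θ).κ ≤ (ℓ F θ).cr ∧ PolLimitsExistOfRecord₁₃ F 2 θ.toStage13Params ∧
        WindowedDecayOfRecord₁₃ F 2 θ.toStage13Params 0 1 (ℓ F θ).κ ∧ WindowedNE9OfRecord₁₃ F 2 θ.toStage13Params (ℓ F θ).κ (ℓ F θ).moduli) :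
    ∀ (F : T4Family) (θ : Stage13HParams F 2) (hP : θ.Provisos₁₃SepCoPH F 2), θ.Admissible F 2 →
      letI := θ.instVβ₁; letI := θ.instVβ₂; letI := θ.instιβ
      BetaContH θ.γ
        (betaOfMerged (betaMerged F (mergedTermFamilyMatT F 2 (TcanOfRecord F 2) (chiFixed29 F 2 θ.ν θ.ε₂₉) θ.εbg) θ.ρ8 θ.bV)
          (beta0OfMerged (betaMerged F (mergedTermFamilyMatT F 2 (TcanOfRecord F 2) (chiFixed29 F 2 θ.ν θ.ε₂₉) θ.εbg) θ.ρ8 θ.bV) θ.v₀) θ.γ) := by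
  intro F θ hP hθ
  obtain ⟨hs, hκ, hcr, hlim, hdec, h9⟩ := h F θ hP hθ
  have hD4 : ReadOutAt (datumOfRecord₁₃SepCoPH F 2 θ hP) (u3OfRecord₁₃ θ.toStage13Params (objectsOfRecord₁₃ F 2 θ.toStage13Params (ℓ F θ)) 0) := by
    rw [datumOfRecord₁₃SepCoPH_eq_coPH]
    exact readOutAt_objectsOfRecord₁₃_coPH θ hP.toCore (ℓ F θ) hs hκ hcr 0
      (kernelDecayOfRecord₁₃_of_windowed F 2 θ.toStage13Params 0 1 (ℓ F θ).κ hlim hdec)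
  exact betaContH_merged_of_readOutAt_n22 θ hP rfl hD4 (n22At_u3OfRecord₁₃_objectsOfRecord₁₃_of_windowed F 2 θ.toStage13Params (ℓ F θ) hs 0 hlim h9)

/-- ★ **BOTH K3⁷-DERIVED STUB BODIES OF K2⁷ LINE 2 FROM ONE LETTER READING** (`N = 2`): if at every admissible ⁷ tuple the block `ℓ F θ` carries the rows
and the FOUR letters (with some run offset `s F θ` for the step rate), then the body of `stub_n17AtRecord13 : N17AtRecord13` (witness = the level-0 kernel
bundle of record: `u.γ = θ.γ` by `rfl`, `0 ≤ u.ρ < 1` from the signs, N17 = the triple's first conjunct) AND the body of `stub_cont13 : ContRecord13`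
(§3) hold.  LOCATED (CRIT-2 ∕ K2⁷ v4 README): line 2's K2-proper content is `stub_d1ResiduePos13 ∧ stub_anchor13`; its N17 and S3 ride on the same four
finite-volume letters of K3⁷ v3's node-U3 pin.  Hypotheses; nothing discharged. [bookkeeping] -/
theorem n17Body_and_contBody_of_fourLetters (ℓ : (F : T4Family) → Stage13HParams F 2 → U3Letters₁₁) (s : (F : T4Family) → Stage13HParams F 2 → ℕ)
    (h : ∀ (F : T4Family) (θ : Stage13HParams F 2) (hP : θ.Provisos₁₃SepCoPH F 2), θ.Admissible F 2 →
      (ℓ F θ).Signs ∧ 0 < (ℓ F θ).κ ∧ betaPrime510 4 1 (ℓ F θ).κ ≤ (ℓ F θ).cr ∧ PolLimitsExistOfRecord₁₃ F 2 θ.toStage13Params ∧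
        WindowedDecayOfRecord₁₃ F 2 θ.toStage13Params 0 1 (ℓ F θ).κ ∧ WindowedNE9OfRecord₁₃ F 2 θ.toStage13Params (ℓ F θ).κ (ℓ F θ).moduli ∧
        WindowedStepRateOfRecord₁₃ F 2 θ.toStage13Params (s F θ) (ℓ F θ).κ (ℓ F θ).θ₅ ((ℓ F θ).C₅ * (ℓ F θ).θ₅)) :
    (∀ (F : T4Family) (θ : Stage13HParams F 2) (hP : θ.Provisos₁₃SepCoPH F 2), θ.Admissible F 2 →
        ∃ u : U3Carriers, u.γ = θ.γ ∧ 0 ≤ u.ρ ∧ u.ρ < 1 ∧ N17At (datumOfRecord₁₃SepCoPH F 2 θ hP) u) ∧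
      ∀ (F : T4Family) (θ : Stage13HParams F 2) (hP : θ.Provisos₁₃SepCoPH F 2), θ.Admissible F 2 →
        letI := θ.instVβ₁; letI := θ.instVβ₂; letI := θ.instιβ
        BetaContH θ.γ
          (betaOfMerged (betaMerged F (mergedTermFamilyMatT F 2 (TcanOfRecord F 2) (chiFixed29 F 2 θ.ν θ.ε₂₉) θ.εbg) θ.ρ8 θ.bV)
            (beta0OfMerged (betaMerged F (mergedTermFamilyMatT F 2 (TcanOfRecord F 2) (chiFixed29 F 2 θ.ν θ.ε₂₉) θ.εbg) θ.ρ8 θ.bV) θ.v₀) θ.γ) := by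
  refine ⟨fun F θ hP hθ => ?_, contRecord13Body_of_threeLetters ℓ fun F θ hP hθ => ?_⟩
  · obtain ⟨hs, hκ, hcr, hlim, hdec, h9, h5⟩ := h F θ hP hθ
    refine ⟨u3OfRecord₁₃ θ.toStage13Params (objectsOfRecord₁₃ F 2 θ.toStage13Params (ℓ F θ)) 0, rfl, hs.ρ_nonneg, hs.ρ_lt_one, ?_⟩
    exact (u2Inputs_datumOfRecord₁₃CoPH_of_kernelLetters θ hP.toCore (ℓ F θ) hs hκ hcr (s F θ) hlim hdec h9 h5).1
  · obtain ⟨hs, hκ, hcr, hlim, hdec, h9, -⟩ := h F θ hP hθ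
    exact ⟨hs, hκ, hcr, hlim, hdec, h9⟩

end Line2

end YMDAG.N17.U2TripleLetters

end
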